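import Summits.NavierStokesRegularity.NavierStokesRegularity.Theorems.AdaptedFrequencyAdaptedKernelExistsWeakCorrectorCalculus
import Literature.Analysis.FluidPDE.WholeSpaceIBP
import Mathlib.MeasureTheory.Integral.IntervalIntegral.FundThmCalculus

/-!
# Crux `AdaptedKernelExists` (stmt-NavierStokesRegularity-2956), line `nash-entropy-last-block`:
  the energy (coercivity) inequality on the strip for STUB `stub_weakCorrector`

Helper file (lands `--supports stmt-NavierStokesRegularity-2956`) for the registered stub
`stub_weakCorrector` (the very weak `L²` corrector by J.-L. Lions' projection lemma, Trèves 1975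
§41).  On the strip `S = (ta, Ta) × ℝ³` and for a smooth compactly supported test function `ψ`
with `ψ(ta, ·) = 0` and a `C¹` drift `b` with divergence-free slices,

  `∫_S ψ² ≤ ∫_S (∂ₜψ + b·∇ψ − νΔψ + ψ) ψ`     (`ν ≥ 0`)

(`weakCorrector_energy`; registered sub-goal `stub_weakCorrector_energy`): by Fubini
(`S` carries the product of Lebesgue measure on `(ta, Ta)` and on `ℝ³`),
`∫_S ψ∂ₜψ = ½∫ ψ(Ta)² ≥ 0` (fundamental theorem of calculus in `t`),
`∫ ψ (b·∇ψ) dx = 0` slice-wise (`div b = 0`, the tree's `integral_inner_convect_add_eq_zero`),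
`−∫ ψΔψ dx = Σᵢ∫ (∂ᵢψ)² ≥ 0` slice-wise (`integral_inner_laplacian_add_eq_zero`).
-/

noncomputable section

open MeasureTheory Set Filter Topology Metric Function intervalIntegral
open scoped ContDiff Laplacian InnerProductSpace

namespace Summit.NavierStokesRegularity.NavierStokesRegularity.Theorems.AdaptedKernelExists.NashEntropyLastBlock

open Literature.Analysis.FluidPDE


section Slices

variable {b : ℝ → (EuclideanSpace ℝ (Fin 3)) → (EuclideanSpace ℝ (Fin 3))} {ψ : ℝ × (EuclideanSpace
    ℝ (Fin 3)) → ℝ}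

/-- **Transport is skew**: `∫ ψ(t,·) (b(t,·)·∇ψ(t,·)) dx = 0` for `C¹` divergence-free `b(t,·)`
and `C¹` compactly supported `ψ(t,·)`. -/
theorem weakCorrector_integral_transport_self {t : ℝ} (hb : ContDiff ℝ 1 (b t))
    (hdiv : VectorCalculus.IsDivFree (b t)) (hψ : ContDiff ℝ 1 fun y : (EuclideanSpace ℝ (Fin 3))
        => ψ (t, y))
    (hψc : HasCompactSupport fun y : (EuclideanSpace ℝ (Fin 3)) => ψ (t, y)) :
    ∫ x, fderiv ℝ (fun y => ψ (t, y)) x (b t x) * ψ (t, x) = 0 := by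
  have h := integral_inner_convect_add_eq_zero hb hψ hψ hψc
  have h0 : (fun x => VectorCalculus.divergence (b t) x *
      ⟪(fun y : (EuclideanSpace ℝ (Fin 3)) => ψ (t, y)) x, (fun y : (EuclideanSpace ℝ (Fin 3)) => ψ
          (t, y)) x⟫_ℝ) = fun _ => 0 := by
    funext x; rw [hdiv x, zero_mul]
  rw [h0, integral_zero, add_zero] at h
  simp only [convect_apply, RCLike.inner_apply, conj_trivial] at h
  have e : ∫ x, (fderiv ℝ (fun y => ψ (t, y)) x) (b t x) * ψ (t, x) =
      ∫ x, ψ (t, x) * (fderiv ℝ (fun y => ψ (t, y)) x) (b t x) :=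
    integral_congr_ae (Eventually.of_forall fun x => mul_comm _ _)
  linarith

/-- **Green**: `∫ Δψ(t,·) ψ(t,·) dx ≤ 0` for `C²` compactly supported `ψ(t,·)`. -/
theorem weakCorrector_integral_laplacian_self_nonpos {t : ℝ} (hψ : ContDiff ℝ 2 fun y :
    (EuclideanSpace ℝ (Fin 3)) => ψ (t, y))
    (hψc : HasCompactSupport fun y : (EuclideanSpace ℝ (Fin 3)) => ψ (t, y)) :
    ∫ x, (Δ (fun y => ψ (t, y))) x * ψ (t, x) ≤ 0 := by
  set e := stdOrthonormalBasis ℝ (EuclideanSpace ℝ (Fin 3))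
  have h := integral_inner_laplacian_add_eq_zero e hψ (hψ.of_le one_le_two) (Or.inl hψc)
  simp only [RCLike.inner_apply, conj_trivial] at h
  have hsum : 0 ≤ ∑ i, ∫ x, (fderiv ℝ (fun y => ψ (t, y)) x) (e i) *
      (fderiv ℝ (fun y => ψ (t, y)) x) (e i) :=
    Finset.sum_nonneg fun i _ => integral_nonneg fun x => mul_self_nonneg _
  have e1 : ∫ x, (Δ (fun y => ψ (t, y))) x * ψ (t, x) = ∫ x, ψ (t, x) * (Δ (fun y => ψ (t, y))) x :=
    integral_congr_ae (Eventually.of_forall fun x => mul_comm _ _)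
  linarith

end Slices

section Energy

variable {ν ta Ta : ℝ} {b : ℝ → (EuclideanSpace ℝ (Fin 3)) → (EuclideanSpace ℝ (Fin 3))} {ψ : ℝ ×
    (EuclideanSpace ℝ (Fin 3)) → ℝ}

/-- **The energy inequality on the strip** (Trèves 1975, (41.7), flat case): for `ν ≥ 0`,
`ta < Ta`, a `C¹` drift `b` with divergence-free slices and a smooth compactly supported `ψ`
with `ψ(ta, ·) = 0`,
`∫_S ψ² ≤ ∫_S (∂ₜψ + b·∇ψ − νΔψ + ψ) ψ`, `S = (ta, Ta) × ℝ³`. -/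
theorem weakCorrector_energy (hν : 0 ≤ ν) (hta : ta < Ta) (hb : ContDiff ℝ 1 (uncurry b))
    (hdiv : ∀ t, VectorCalculus.IsDivFree (b t)) (hψ : ContDiff ℝ ∞ ψ)
    (hψc : HasCompactSupport ψ) (hψ0 : ∀ x, ψ (ta, x) = 0) :
    ∫ p in Ioo ta Ta ×ˢ univ, ψ p ^ 2 ≤
      ∫ p in Ioo ta Ta ×ˢ univ, (deriv (fun s => ψ (s, p.2)) p.1 +
        fderiv ℝ (fun y => ψ (p.1, y)) p.2 (b p.1 p.2) -
        ν * (Δ (fun y => ψ (p.1, y))) p.2 + ψ p) * ψ p := by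
  set S : Set (ℝ × (EuclideanSpace ℝ (Fin 3))) := Ioo ta Ta ×ˢ univ with hS
  set μt : Measure ℝ := volume.restrict (Ioo ta Ta) with hμt
  haveI : IsFiniteMeasure μt := ⟨by
    rw [hμt, Measure.restrict_apply_univ]; exact measure_Ioo_lt_top⟩
  have hπ : (volume : Measure (ℝ × (EuclideanSpace ℝ (Fin 3)))).restrict S = μt.prod volume := by
    rw [hμt, show (volume : Measure (ℝ × (EuclideanSpace ℝ (Fin 3)))) = (volume : Measure ℝ).prod
        (volume : Measure (EuclideanSpace ℝ (Fin 3)))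
      from rfl, hS, ← Measure.prod_restrict, Measure.restrict_univ]
  -- the slice fields
  obtain ⟨A, hA⟩ : ∃ A : ℝ × (EuclideanSpace ℝ (Fin 3)) → ℝ, A = fun p => deriv (fun s => ψ (s,
      p.2)) p.1 := ⟨_, rfl⟩
  obtain ⟨Bf, hBf⟩ : ∃ Bf : ℝ × (EuclideanSpace ℝ (Fin 3)) → ℝ,
      Bf = fun p => fderiv ℝ (fun y => ψ (p.1, y)) p.2 (b p.1 p.2) := ⟨_, rfl⟩
  obtain ⟨L, hL⟩ : ∃ L : ℝ × (EuclideanSpace ℝ (Fin 3)) → ℝ, L = fun p => (Δ (fun y => ψ (p.1, y)))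
      p.2 := ⟨_, rfl⟩
  have hψ1 := weakCorrector_contDiff_one_of_infty hψ
  have hψ2 := weakCorrector_contDiff_two_of_infty hψ
  have hbc : Continuous (uncurry b) := hb.continuous
  have cA : Continuous A := hA ▸ weakCorrector_continuous_deriv_slice hψ1
  have cB : Continuous Bf := hBf ▸ weakCorrector_continuous_fderiv_slice hψ1 hbc
  have cL : Continuous L := hL ▸ weakCorrector_continuous_laplacian_slice hψ
  have cψ : Continuous ψ := hψ.continuous
  have hint : ∀ {f : ℝ × (EuclideanSpace ℝ (Fin 3)) → ℝ}, Continuous f →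
      Integrable (fun p => f p * ψ p) (μt.prod volume) := by
    intro f hf
    rw [← hπ]
    exact ((hf.mul cψ).integrable_of_hasCompactSupport hψc.mul_left).integrableOn
  have iA := hint cA
  have iB := hint cB
  have iL := hint cL
  have iψ := hint cψ
  -- rewrite the claim on the product measure
  have hdec : ∀ p, (deriv (fun s => ψ (s, p.2)) p.1 +
      fderiv ℝ (fun y => ψ (p.1, y)) p.2 (b p.1 p.2) -
      ν * (Δ (fun y => ψ (p.1, y))) p.2 + ψ p) * ψ p =
      A p * ψ p + Bf p * ψ p - ν * (L p * ψ p) + ψ p * ψ p := by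
    intro p; rw [hA, hBf, hL]; ring
  have hsq : ∀ p, ψ p ^ 2 = ψ p * ψ p := fun p => sq _
  simp_rw [hdec, hsq]
  change ∫ p, ψ p * ψ p ∂(volume.restrict S) ≤ ∫ p, _ ∂(volume.restrict S)
  have i12 : Integrable (fun p => A p * ψ p + Bf p * ψ p) (μt.prod volume) := iA.add iB
  have i3 : Integrable (fun p => ν * (L p * ψ p)) (μt.prod volume) := iL.const_mul ν
  have i123 : Integrable (fun p => A p * ψ p + Bf p * ψ p - ν * (L p * ψ p)) (μt.prod volume) :=
    i12.sub i3
  rw [hπ, integral_add i123 iψ, integral_sub i12 i3, integral_add iA iB,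
    MeasureTheory.integral_const_mul]
  -- interval-integral form of the `μt`-integrals
  have hI : ∀ f : ℝ → ℝ, ∫ s, f s ∂μt = ∫ s in ta..Ta, f s := fun f => by
    rw [hμt, intervalIntegral.integral_of_le hta.le, integral_Ioc_eq_integral_Ioo]
  -- (i) the time term is nonnegative
  have h1 : 0 ≤ ∫ p, A p * ψ p ∂μt.prod volume := by
    rw [integral_prod_symm _ iA]
    refine integral_nonneg fun x => ?_
    change (0 : ℝ) ≤ ∫ t, A (t, x) * ψ (t, x) ∂μt
    rw [hI]
    have hd : ∀ s, HasDerivAt (fun s' => ψ (s', x)) (A (s, x)) s := fun s => by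
      rw [hA]
      exact ((weakCorrector_contDiff_slice_t hψ1 x).differentiable one_ne_zero s).hasDerivAt
    have hE : ∀ s, HasDerivAt (fun s' => ψ (s', x) * ψ (s', x))
        (A (s, x) * ψ (s, x) + ψ (s, x) * A (s, x)) s := fun s => (hd s).fun_mul (hd s)
    have hcE : Continuous fun s => A (s, x) * ψ (s, x) + ψ (s, x) * A (s, x) :=
      ((cA.comp (continuous_id.prodMk continuous_const)).mul
        (cψ.comp (continuous_id.prodMk continuous_const))).add
        ((cψ.comp (continuous_id.prodMk continuous_const)).mul
        (cA.comp (continuous_id.prodMk continuous_const)))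
    have hFTC : ∫ s in ta..Ta, (A (s, x) * ψ (s, x) + ψ (s, x) * A (s, x)) =
        ψ (Ta, x) * ψ (Ta, x) - ψ (ta, x) * ψ (ta, x) :=
      integral_eq_sub_of_hasDerivAt (fun s _ => hE s) (hcE.intervalIntegrable ta Ta)
    have h2 : ∫ s in ta..Ta, (A (s, x) * ψ (s, x) + ψ (s, x) * A (s, x)) =
        2 * ∫ s in ta..Ta, A (s, x) * ψ (s, x) := by
      rw [← intervalIntegral.integral_const_mul]
      exact intervalIntegral.integral_congr fun s _ => by ring
    rw [hψ0 x] at hFTC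
    nlinarith [mul_self_nonneg (ψ (Ta, x))]
  -- (ii) the transport term vanishes
  have h2 : ∫ p, Bf p * ψ p ∂μt.prod volume = 0 := by
    rw [integral_prod _ iB]
    have hslice : ∀ t, ∫ x, Bf (t, x) * ψ (t, x) = 0 := fun t => by
      rw [hBf]
      exact weakCorrector_integral_transport_self
        (hb.comp (contDiff_const.prodMk contDiff_id)) (hdiv t)
        (weakCorrector_contDiff_slice_x hψ1 t) (weakCorrector_hasCompactSupport_slice hψc t)
    simp_rw [hslice, MeasureTheory.integral_zero]
  -- (iii) the viscous term is nonnegative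
  have h3 : ∫ p, L p * ψ p ∂μt.prod volume ≤ 0 := by
    rw [integral_prod _ iL]
    refine integral_nonpos fun t => ?_
    change ∫ x, L (t, x) * ψ (t, x) ≤ (0 : ℝ)
    rw [hL]
    exact weakCorrector_integral_laplacian_self_nonpos (weakCorrector_contDiff_slice_x hψ2 t)
      (weakCorrector_hasCompactSupport_slice hψc t)
  have h3' : ν * ∫ p, L p * ψ p ∂μt.prod volume ≤ 0 := mul_nonpos_of_nonneg_of_nonpos hν h3
  linarith

/-- **Registered sub-goal `stub_weakCorrector_energy`** (closed form of `weakCorrector_energy`):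
the coercivity of `∂ₜ + b·∇ − νΔ + 1` on the strip `(ta, Ta) × ℝ³` against test functions
vanishing at `t = ta`. -/
theorem stub_weakCorrector_energy :
    ∀ (ν ta Ta : ℝ) (b : ℝ → EuclideanSpace ℝ (Fin 3) → EuclideanSpace ℝ (Fin 3)) (ψ : ℝ × EuclideanSpace ℝ (Fin 3) → ℝ), 0 ≤ ν → ta < Ta → ContDiff ℝ 1 (uncurry b) → (∀ t, VectorCalculus.IsDivFree (b t)) → ContDiff ℝ ∞ ψ → HasCompactSupport ψ → (∀ x, ψ (ta, x) = 0) → ∫ p in Ioo ta Ta ×ˢ univ, ψ p ^ 2 ≤ ∫ p in Ioo ta Ta ×ˢ univ, (deriv (fun s => ψ (s, p.2)) p.1 + fderiv ℝ (fun y => ψ (p.1, y)) p.2 (b p.1 p.2) - ν * (Δ (fun y => ψ (p.1, y))) p.2 + ψ p) * ψ p :=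
  fun _ _ _ _ _ hν hta hb hdiv hψ hψc hψ0 => weakCorrector_energy hν hta hb hdiv hψ hψc hψ0

end Energy

end Summit.NavierStokesRegularity.NavierStokesRegularity.Theorems.AdaptedKernelExists.NashEntropyLastBlock

end
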